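import Mathlib
import HarnessLib
import Summits.HubbardSuperconductivity.HubbardSuperconductivity.Theorems.KLProgrammeC4aBubbleTubeDeriv
import Summits.HubbardSuperconductivity.HubbardSuperconductivity.Theorems.KLProgrammeC4aPartnerBandCrossings
import Summits.HubbardSuperconductivity.HubbardSuperconductivity.Theorems.KLProgrammeC4aAbsBubbleDirectSheet

/-!
# Route `KLProgramme` — crux C4a, S3 brick (B4) «(U1)-HYBRID» part D-1b: THE CURRENCY IDENTITY — the first-order geometric factor of the absolute loop angle equals the
# co-moving anisotropy defect minus the loop slope, `G = 𝒜_φ − ∂_vē`, and on a loop window with a numerator vanishing at the ends the slope part integrates by parts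
# for free: `∫ X·G·(K e)′(ē) = ∫ X·𝒜_φ·(K e)′(ē) + ∫ X′·K(ē)`

Cell `gate-hubbard-kl`, seat hubbard-kl-k3c3-p3 (g36; row «implicit-function / monotonicity route for μ(n)»).  Located brick for the (C)-closer lane / the (M4)
assembly of the first-order ϑ-layer (stub (C) `stub_twoLeg_curvature` of `KLRegimeEngineV17F2`, stmt-HubbardSuperconductivity-20437), memo
HOME/hubbard-kl-k3c3-p3/U1-CAUSTIC-SUP.md §19 «(U1)-HYBRID» (D-1)/(D-2).

WHY.  The umklapp ladder (U7) bounds the ABSOLUTE-angle form of the first-order layer, numerator `X·G` with `G(ϑ,e,v) = De_K(S(ϑ) − Φ(e,v+θ))[S′(ϑ)]` — `O(1)` on umklapp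
sheets.  On the DIRECT sheet (the tangency and Cooper parts `χ_dir·J·G`, `χ_C·J·G` of the hybrid split) the right currency is the CO-MOVING one: the base-angle derivative at
fixed co-moving loop angle, `𝒜_φ = ∂_ψ|_θ e_K(Φ(0,ψ) + Φ(ρ,ϑ+ψ) − Φ(e,v+ψ)) = De_K(P)[S′ − ∂_sΦ(e,v+θ)]` (c4a-1 `hasDerivAt_partnerBand_pp_base`), which the KEY LEMMA of
B4-DIRECT-COUNT bounds by the band distances (`…C4aKeyLemmaTangency`).  Since `∂_vē = −De_K(P)[∂_sΦ(e,v+θ)]` (`hasDerivAt_partnerBand_pp_angle`), POINTWISE `G = 𝒜_φ − ∂_vē`,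
and `X·(−∂_vē)·(K e)′(ē) = −X·∂_v[K(ē)]` integrates by parts onto `X′·K(ē)` with no boundary term when `X` vanishes at the window ends (bumped numerator) — a `k = 0` term.
* **`geomFactor_eq_anisotropy_sub_slope`** — the pointwise identity;
* **`intervalIntegral_numerator_geomFactor_eq`** (HEADLINE) — `∫_a^b X·(G·(K e)′(ē)) = ∫_a^b X·(𝒜_φ·(K e)′(ē)) + ∫_a^b X′·K(ē)` for `X ∈ C¹` with `X(a) = X(b) = 0`, `K ∈ C¹`,
  `|e| < r`;
* `abs_intervalIntegral_numerator_geomFactor_le` — the triangle-inequality form the direct-part counts start from.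
Sizes binder shape; pure calculus on landed objects; nothing asserts (C), K3 or superconductivity.
References: FST II CPAM 51 (1998) §3 [cite: FeldmanSalmhoferTrubowitz1998]; BGM 2006 §2.4 [cite: BenfattoGiulianiMastropietro2006].
-/

noncomputable section

namespace Summit.HubbardSuperconductivity.HubbardSuperconductivity.Theorems.C4a

set_option linter.dupNamespace false -- summit = problem name (single-conjunct summit), D-0017

open Real Set Filter MeasureTheory intervalIntegral
open scoped Topology
open Literature.MathematicalPhysics.QuantumLattice Literature.MathematicalPhysics.QuantumLattice.BandSectorCounting Literature.Probability.LatticeModels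
open Summit.HubbardSuperconductivity.HubbardSuperconductivity.Theorems.KLRegimeSplit
open Summit.HubbardSuperconductivity.HubbardSuperconductivity.Theorems.DispersionFlow
open Summit.HubbardSuperconductivity.HubbardSuperconductivity.Theorems.PerturbedFermiCurve

section Sizes

variable {K : TrigPolyC4v} {A : ℝ} (hA : ∀ p : Momentum, ∀ j ≤ 2, ‖iteratedFDeriv ℝ j (frameShift K) p‖ ≤ A) (hA20 : A ≤ 1 / 20)
  (hd : klCurveD ≤ (bandBounds (show (-4 : ℝ) < -1.1 by norm_num) (show (-1.1 : ℝ) ≤ -0.1 by norm_num)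
    (show (-0.1 : ℝ) < 0 by norm_num)).Dtmin - 2 * A)
  {μ r : ℝ} (hr : 0 < r) (hlo : (-1.1 : ℝ) < μ - r - A) (hhi : μ + r + A < -0.1)
include hA hA20 hd hr hlo hhi

omit hA20 in
/-- **THE CURRENCY IDENTITY, POINTWISE**: with `P = S(ϑ) − Φ(e,v+θ)`, `S(ϑ) = Φ(0,θ) + Φ(ρ,ϑ+θ)`, `S′ = ∂_sΦ(0,θ) + ∂_sΦ(ρ,ϑ+θ)`:
`De_K(P)[S′] = ∂_ψ|_θ e_K(Φ(0,ψ) + Φ(ρ,ϑ+ψ) − Φ(e,v+ψ)) − ∂_v e_K(S(ϑ) − Φ(e,v+θ))` (`|ρ|, |e| < r`). -/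
theorem geomFactor_eq_anisotropy_sub_slope {ρ e : ℝ} (hρ : |ρ| < r) (he : |e| < r) (ϑ θ v : ℝ) :
    (fderiv ℝ (frameLevel μ K) (pairSumPath μ K ρ ϑ θ 0 - levelPoint μ K e (v + θ)))
        (iteratedDeriv 1 (levelPoint μ K 0) θ + iteratedDeriv 1 (levelPoint μ K ρ) (ϑ + θ)) =
      deriv (fun ψ : ℝ => frameLevel μ K (levelPoint μ K 0 ψ + levelPoint μ K ρ (ϑ + ψ) - levelPoint μ K e (v + ψ))) θ -
        deriv (fun x : ℝ => frameLevel μ K (pairSumPath μ K ρ ϑ θ 0 - levelPoint μ K e (x + θ))) v := by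
  have hS : pairSumPath μ K ρ ϑ θ 0 = levelPoint μ K 0 θ + levelPoint μ K ρ (ϑ + θ) := by simp only [pairSumPath, add_zero]
  rw [(hasDerivAt_partnerBand_pp_base hA hd hr hlo hhi hρ he ϑ v θ).deriv, (hasDerivAt_partnerBand_pp_angle hA hd hlo hhi he ϑ θ v).deriv, hS,
    map_sub, sub_neg_eq_add, sub_add_cancel]

omit hA20 in
/-- **THE CURRENCY IDENTITY UNDER THE LOOP INTEGRAL** (HEADLINE): on a loop window `[a,b]` with a `C¹` numerator `X` vanishing at both ends and a `C¹` kernel `K`,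
`∫_a^b X·(G·K′(ē)) = ∫_a^b X·(𝒜_φ·K′(ē)) + ∫_a^b X′·K(ē)` — the slope part of `G` is a free integration by parts onto `X′` (no boundary term). -/
theorem intervalIntegral_numerator_geomFactor_eq {ρ e : ℝ} (hρ : |ρ| < r) (he : |e| < r) (ϑ θ : ℝ) {a b : ℝ} {X Kr : ℝ → ℝ}
    (hX : ContDiff ℝ 1 X) (hXa : X a = 0) (hXb : X b = 0) (hK : ContDiff ℝ 1 Kr) :
    ∫ v in a..b, X v * ((fderiv ℝ (frameLevel μ K) (pairSumPath μ K ρ ϑ θ 0 - levelPoint μ K e (v + θ)))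
        (iteratedDeriv 1 (levelPoint μ K 0) θ + iteratedDeriv 1 (levelPoint μ K ρ) (ϑ + θ)) *
        deriv Kr (frameLevel μ K (pairSumPath μ K ρ ϑ θ 0 - levelPoint μ K e (v + θ)))) =
      (∫ v in a..b, X v * (deriv (fun ψ : ℝ => frameLevel μ K (levelPoint μ K 0 ψ + levelPoint μ K ρ (ϑ + ψ) - levelPoint μ K e (v + ψ))) θ *
        deriv Kr (frameLevel μ K (pairSumPath μ K ρ ϑ θ 0 - levelPoint μ K e (v + θ))))) +
      ∫ v in a..b, deriv X v * Kr (frameLevel μ K (pairSumPath μ K ρ ϑ θ 0 - levelPoint μ K e (v + θ))) := by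
  set g : ℝ → ℝ := fun x => frameLevel μ K (pairSumPath μ K ρ ϑ θ 0 - levelPoint μ K e (x + θ)) with hg
  have hgC : ContDiff ℝ 1 g := contDiff_partnerBand_pp_angle hA hd hlo hhi ρ he ϑ θ 1
  have hgd : ∀ x, HasDerivAt g (deriv g x) x := fun x => ((hgC.differentiable (by norm_num)) x).hasDerivAt
  have hKd : ∀ u, HasDerivAt Kr (deriv Kr u) u := fun u => ((hK.differentiable (by norm_num)) u).hasDerivAt
  have hXd : ∀ x, HasDerivAt X (deriv X x) x := fun x => ((hX.differentiable (by norm_num)) x).hasDerivAt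
  -- pointwise: G = 𝒜 − g′
  have hpt : ∀ v, X v * ((fderiv ℝ (frameLevel μ K) (pairSumPath μ K ρ ϑ θ 0 - levelPoint μ K e (v + θ)))
        (iteratedDeriv 1 (levelPoint μ K 0) θ + iteratedDeriv 1 (levelPoint μ K ρ) (ϑ + θ)) * deriv Kr (g v)) =
      X v * (deriv (fun ψ : ℝ => frameLevel μ K (levelPoint μ K 0 ψ + levelPoint μ K ρ (ϑ + ψ) - levelPoint μ K e (v + ψ))) θ * deriv Kr (g v)) +
        (-(X v * (deriv Kr (g v) * deriv g v))) := by
    intro v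
    rw [geomFactor_eq_anisotropy_sub_slope hA hd hr hlo hhi hρ he ϑ θ v]
    ring
  -- the slope part: ∫ X·(K′(g)·g′) = [X·K(g)] − ∫ X′·K(g) = −∫ X′·K(g)
  have hcomp : ∀ x ∈ uIcc a b, HasDerivAt (fun x => Kr (g x)) (deriv Kr (g x) * deriv g x) x := fun x _ => (hKd (g x)).comp x (hgd x)
  have hX' : IntervalIntegrable (fun x => deriv X x) volume a b := (hX.continuous_deriv le_rfl).intervalIntegrable _ _
  have hcont : Continuous fun x => deriv Kr (g x) * deriv g x :=
    ((hK.continuous_deriv le_rfl).comp hgC.continuous).mul (hgC.continuous_deriv le_rfl)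
  have hibp := intervalIntegral.integral_mul_deriv_eq_deriv_mul (u := X) (v := fun x => Kr (g x)) (fun x _ => hXd x) hcomp hX'
    (hcont.intervalIntegrable _ _)
  rw [hXa, hXb, zero_mul, zero_mul, sub_zero, zero_sub] at hibp
  -- assemble
  have hI1 : IntervalIntegrable (fun v => X v * (deriv (fun ψ : ℝ => frameLevel μ K (levelPoint μ K 0 ψ + levelPoint μ K ρ (ϑ + ψ) -
      levelPoint μ K e (v + ψ))) θ * deriv Kr (g v))) volume a b := by
    refine ((hX.continuous.mul ((Continuous.mul ?_ ((hK.continuous_deriv le_rfl).comp hgC.continuous)))).intervalIntegrable _ _)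
    -- continuity of v ↦ 𝒜_φ(v): by the identity, 𝒜 = G + g′, both continuous in v
    have hG : Continuous fun v : ℝ => (fderiv ℝ (frameLevel μ K) (pairSumPath μ K ρ ϑ θ 0 - levelPoint μ K e (v + θ)))
        (iteratedDeriv 1 (levelPoint μ K 0) θ + iteratedDeriv 1 (levelPoint μ K ρ) (ϑ + θ)) := by
      have hfe : Continuous (fderiv ℝ (frameLevel μ K)) := (EngineV8.contDiff_frameLevel μ K (n := 1)).continuous_fderiv one_ne_zero
      have hP : Continuous fun v : ℝ => pairSumPath μ K ρ ϑ θ 0 - levelPoint μ K e (v + θ) :=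
        continuous_const.sub ((contDiff_levelPoint_of_sizes hA hd hlo hhi he 0).continuous.comp (continuous_id.add continuous_const))
      exact (hfe.comp hP).clm_apply continuous_const
    have heq : (fun v : ℝ => deriv (fun ψ : ℝ => frameLevel μ K (levelPoint μ K 0 ψ + levelPoint μ K ρ (ϑ + ψ) - levelPoint μ K e (v + ψ))) θ) =
        fun v => (fderiv ℝ (frameLevel μ K) (pairSumPath μ K ρ ϑ θ 0 - levelPoint μ K e (v + θ)))
          (iteratedDeriv 1 (levelPoint μ K 0) θ + iteratedDeriv 1 (levelPoint μ K ρ) (ϑ + θ)) + deriv g v := by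
      funext v; rw [geomFactor_eq_anisotropy_sub_slope hA hd hr hlo hhi hρ he ϑ θ v]; simp [hg]
    rw [heq]; exact hG.add (hgC.continuous_deriv le_rfl)
  have hI2 : IntervalIntegrable (fun v => -(X v * (deriv Kr (g v) * deriv g v))) volume a b := ((hX.continuous.mul hcont).intervalIntegrable _ _).neg
  rw [intervalIntegral.integral_congr (fun v _ => hpt v), intervalIntegral.integral_add hI1 hI2, intervalIntegral.integral_neg, hibp]
  ring

end Sizes

end Summit.HubbardSuperconductivity.HubbardSuperconductivity.Theorems.C4a

end
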